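import Summits.ResolutionOfSingularities.ResolutionOfSingularities.Theorems.FloorCutClasses
import Summits.ResolutionOfSingularities.ResolutionOfSingularities.Theorems.FloorCutFloor
import Summits.ResolutionOfSingularities.ResolutionOfSingularities.Theorems.ConeCutAxisLaw
import Summits.ResolutionOfSingularities.ResolutionOfSingularities.Theorems.BoundaryLedgerClasses
import Summits.ResolutionOfSingularities.ResolutionOfSingularities.Theorems.ItineraryCutClasses
import Summits.ResolutionOfSingularities.ResolutionOfSingularities.Theorems.ProximityCutClasses
import Summits.ResolutionOfSingularities.ResolutionOfSingularities.Theorems.ProximityCutOrigin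
import Literature.AlgebraicGeometry.Resolution.HasseSchmidtDiffEqDiffOp
import Literature.AlgebraicGeometry.Resolution.PointBlowupKangaroo
import HarnessLib

/-!
# ConeCutLayers — tree file 2/11: §A the residual cone calculus at STATE level, part 1 — initial / residual
layers (`initLayer`,
`resLayer`), their behaviour under the point transform and translation, the layer identities.  PROVED.

Content VERBATIM from the decomp-res lens-3 g15 file `HOME/decomp-res-lens-3/g15/parts/ConeCut-rev5-f76e5309.lean`
(sha256 f76e53096babc227…; CRITIC-LEDGER
rows 102/105/110/123 CLEARED, landing orders 15:53:15Z / 17:40:15Z).  HOME = run/shared/lean/pub/decomp-res.  Host: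
route `MaxContactCut`, aside
31770 `DefectWalksDeep` (and 31870) through the tree's lens-3 g14 `Theorems/FloorCut{Classes,Floor}` + `MaxContactCutFloorCut`.

[WRITER NOTE (decomp-res writer g6): per the lens's own landing instruction its §0 (l.130–876 = g14 `FloorCut`
VERBATIM) is DELETED and the
tree's `…Theorems.FloorCut` opened instead; §C⁵ `section AxisLaw` (l.2949–3086) is the tree's
`Theorems/ConeCutAxisLaw` (landed earlier,
opened here); the restated ProximityCut letters `LeavesNewest` / `StaysOnNewest` / `leavesNewest_iff_not_stays` /
`NoFreePointTailsDeep`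
(byte-identical to `Theorems/ProximityCutClasses`) are deleted and opened from the tree; the three class definitions
`IsTameFrom`,
`NoMixedTailsDeep`, `NoTameMixedTailsDeep` live in the cone-free `Theorems/ConeCutClasses` (so the route can import
the co-owned MIXED
aside).  Split: ConeCutClasses · ConeCutLayers / ConeCutLayersPoint (§A state level) · ConeCutWalks (§B) ·
ConeCutLawB (§C) · ConeCutRepeats
(§B⁺, §B⁺⁺⁺ part 1) · ConeCutLawE (§B⁺⁺⁺ part 2, LAW E) · ConeCutZigzag (§B⁺⁺
Fibonacci/zigzag, LAW C) · ConeCutLaws (all-repeat rigidity,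
LAW I, §D booking) · MaxContactCutConeCut / MaxContactCutConeCutCells (§D wiring to 31770/31870 BY NAME, Theses
cone).  ONE namespace
`…Theorems.ConeCut` as in the lens; global `set_option` lines dropped; nothing else changed.]
(Sources: Hauser2010 §§D,F,G; HauserPerlega2019; Moh1987; CossartPiltant2019; CossartJannsenSaito2020 Thm. 2.14,
§§5,9; BenitoVillamayor2013 §7; CasasAlvero2000 Ch. 3; BierstoneGrigorievMilmanWlodarczyk2011 Def. 3.1.3.)
-/

noncomputable section

open MvPolynomial Finset
open Literature.AlgebraicGeometry.Resolution
open Literature.AlgebraicGeometry.Resolution.Hauser2010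
open Literature.AlgebraicGeometry.Resolution.PointBlowup
open Summit.ResolutionOfSingularities.ResolutionOfSingularities.Theorems.TightDefectClasses
open Summit.ResolutionOfSingularities.ResolutionOfSingularities.Theorems.TightDefectStrongWalks
open Summit.ResolutionOfSingularities.ResolutionOfSingularities.Theorems.ItineraryCutClasses
open Summit.ResolutionOfSingularities.ResolutionOfSingularities.Theorems.BoundaryLedger
open Literature.AlgebraicGeometry.Resolution.WeightedBlowup
open Literature.Barriers.ResolutionOfSingularities
open Summit.ResolutionOfSingularities.ResolutionOfSingularities.Theorems.FloorCut
open Summit.ResolutionOfSingularities.ResolutionOfSingularities.Theorems.ConeCutAxisLaw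
open Summit.ResolutionOfSingularities.ResolutionOfSingularities.Theorems.ProximityCut (NoOriginTails LeavesNewest StaysOnNewest)
open Summit.ResolutionOfSingularities.ResolutionOfSingularities.Theorems.ProximityCut (leavesNewest_iff_not_stays NoFreePointTailsDeep)

namespace Summit.ResolutionOfSingularities.ResolutionOfSingularities.Theorems.ConeCut

/-! ## §A–§C THE RESIDUAL CONE CALCULUS (new, g15) -/

section StateLevel

variable {σ : Type*} {K : Type*} [Field K] [Fintype σ] [DecidableEq σ] [DecidableEq K]

/-- The INITIAL LAYER of `F` at degree `o`, dehomogenised at the chart variable `u_j` (`u_j := 1`):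
`L = Σ_{|d| = o} c_d · u^{d[j ↦ 0]}`.  DEFINITION (support). -/
def initLayer (j : σ) (F : MvPolynomial σ K) (o : ℕ) : MvPolynomial σ K :=
  ∑ d ∈ F.support with d.degree = o, monomial (d.update j 0) (coeff d F)

/-- The RESIDUAL LAYER of a state at degree `o`: the initial layer divided by the boundary monomial away from `u_j`,
`M = Σ_{|d| = o} c_d · u^{(d − r)[j ↦ 0]}` — the residual tangent cone `R = in_o(F)/u^r` dehomogenised at `u_j`.
DEFINITION (support). -/
def resLayer (j : σ) (s : State σ K) (o : ℕ) : MvPolynomial σ K :=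
  ∑ d ∈ s.F.support with d.degree = o, monomial ((d - s.r).update j 0) (coeff d s.F)

omit [DecidableEq K] [Fintype σ] in
/-- `update_apply'`: Auxiliary step of this node's calculus, VERBATIM from the lens file (see the module docstring); the statement is its type. [folklore] -/
theorem update_apply' (d : σ →₀ ℕ) (j : σ) (v : ℕ) (k : σ) : (d.update j v) k = if k = j then v else d k := by
  rw [Finsupp.coe_update, Function.update_apply]

/-- Below `2q`, a non-zero `q`-th power exponent is `q·e_i`. [folklore] -/
theorem eq_single_of_isPthPowerExponent {q : ℕ} (hq : 0 < q) {D : σ →₀ ℕ} (hD0 : D ≠ 0) (hD : D.degree < 2 * q)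
    (hP : IsPthPowerExponent q D) : ∃ i, D = Finsupp.single i q := by
  classical
  rw [isPthPowerExponent_iff] at hP
  obtain ⟨i, hi⟩ : ∃ i, D i ≠ 0 := by
    by_contra h
    push Not at h
    exact hD0 (Finsupp.ext fun k => by rw [h k, Finsupp.zero_apply])
  have hqi : q ≤ D i := Nat.le_of_dvd (Nat.pos_of_ne_zero hi) (hP i)
  have hsum := degree_eq_add_sum_erase i D
  refine ⟨i, Finsupp.ext fun k => ?_⟩
  by_cases hk : k = i
  · subst hk
    rw [Finsupp.single_eq_same]
    obtain ⟨c, hc⟩ := hP k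
    have hc2 : c < 2 := by
      by_contra h2
      have : 2 * q ≤ q * c := by nlinarith
      omega
    interval_cases c
    · omega
    · omega
  · rw [Finsupp.single_apply, if_neg (fun h => hk h.symm)]
    have hle : D k ≤ ∑ l ∈ univ.erase i, D l :=
      Finset.single_le_sum (fun l _ => Nat.zero_le (D l)) (Finset.mem_erase.mpr ⟨hk, Finset.mem_univ k⟩)
    have hlt : D k < q := by omega
    obtain ⟨c, hc⟩ := hP k
    rcases Nat.eq_zero_or_pos c with h0 | hpos
    · rw [hc, h0, mul_zero]
    · have : q ≤ D k := by rw [hc]; exact Nat.le_mul_of_pos_right q hpos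
      omega

/-- **LAYER VANISHING (PROVED).**  At an equimultiple point whose next (cleaned) state has order `o' < 2q`, every
monomial of the point transform of degree `< o'` is a pure `q`-th power `u_i^q`. [new] [folklore] -/
theorem coeff_pointTransform_eq_zero_of_lt {q : ℕ} (hq : 0 < q) (j : σ) (b : σ → K) (s : State σ K)
    (hequi : IsEquimultiplePoint q j b s) {o' : ℕ} (ho' : ordZero (step q j b s).F = o') (ho'2 : o' < 2 * q)
    {D : σ →₀ ℕ} (hD0 : D ≠ 0) (hDo : D.degree < o') (hDq : ∀ i, D ≠ Finsupp.single i q) :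
    coeff D (pointTransform q j b s) = 0 := by
  classical
  by_cases hlt : D.degree < q
  · exact hequi D hD0 hlt
  · have hc : coeff D (step q j b s).F = 0 := ((ordZero_eq_nat_iff _ _).mp ho').2 D hDo
    have hstep : (step q j b s).F = deletePthPowers q (pointTransform q j b s) := rfl
    rw [hstep, coeff_deletePthPowers] at hc
    split_ifs at hc with hP
    · obtain ⟨i, hi⟩ := eq_single_of_isPthPowerExponent hq hD0 (by omega) hP
      exact absurd hi (hDq i)
    · exact hc

omit [DecidableEq K] in
/-- **THE LAYER IDENTITY (PROVED).**  The `u_j^{o−q}`-layer of the point transform is the translated initial layer: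
`coeff_D (F⁺) = coeff_{D[j↦0]} (translate b L)` for `D_j = o − q` (`o > q`). [new] [folklore] -/
theorem coeff_pointTransform_layer (q : ℕ) (j : σ) (b : σ → K) (hbj : b j = 0) (s : State σ K) {o : ℕ} (hqo : q < o)
    {D : σ →₀ ℕ} (hDj : D j = o - q) :
    coeff D (pointTransform q j b s) = coeff (D.update j 0) (translate b (initLayer j s.F o)) := by
  classical
  unfold initLayer
  rw [pointTransform_eq_sum, translate_finset_sum, coeff_sum, coeff_sum, Finset.sum_filter]
  refine Finset.sum_congr rfl fun d hd => ?_
  by_cases hdo : d.degree = o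
  · rw [if_pos hdo, coeff_translate_monomial, coeff_translate_monomial]
    congr 1
    refine Finset.prod_congr rfl fun i _ => ?_
    by_cases hij : i = j
    · subst hij
      rw [chartExponent_apply, if_pos rfl, update_apply', if_pos rfl, update_apply', if_pos rfl, hDj, hdo]
      simp
    · rw [chartExponent_apply, if_neg hij, update_apply', if_neg hij, update_apply', if_neg hij]
  · rw [if_neg hdo]
    have hne : chartExponent q j d j ≠ D j := by
      rw [chartExponent_apply, if_pos rfl, hDj]
      omega
    rcases lt_or_gt_of_ne hne with hlt | hgt
    · exact coeff_translate_monomial_eq_zero_of_lt b _ _ _ hlt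
    · exact coeff_translate_monomial_eq_zero_of_apply_eq_zero b _ _ _ hbj hgt

omit [DecidableEq K] in
/-- The translated initial layer does not involve `u_j`. [folklore] -/
theorem coeff_translate_initLayer_eq_zero (j : σ) (b : σ → K) (_hbj : b j = 0) (F : MvPolynomial σ K) (o : ℕ)
    {E : σ →₀ ℕ} (hEj : E j ≠ 0) : coeff E (translate b (initLayer j F o)) = 0 := by
  classical
  unfold initLayer
  rw [translate_finset_sum, coeff_sum]
  refine Finset.sum_eq_zero fun d _ => coeff_translate_monomial_eq_zero_of_lt b _ _ _ (i := j) ?_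
  rw [update_apply', if_pos rfl]
  exact Nat.pos_of_ne_zero hEj

/-- **THE TRANSLATED INITIAL LAYER HAS ORDER `≥ o' − (o − q)` (PROVED)** at an equimultiple point of a state of order
`q < o < 2q` whose next state has order `o' < 2q`. [new] [folklore] -/
theorem le_ordZero_translate_initLayer {q : ℕ} (hq : 0 < q) (j : σ) (b : σ → K) (hbj : b j = 0) (s : State σ K)
    (hequi : IsEquimultiplePoint q j b s) {o o' : ℕ} (hqo : q < o) (ho2 : o < 2 * q)
    (ho' : ordZero (step q j b s).F = o') (ho'2 : o' < 2 * q) :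
    (((o' - (o - q) : ℕ)) : ℕ∞) ≤ ordZero (translate b (initLayer j s.F o)) := by
  classical
  rw [natCast_le_ordZero_iff_forall_coeff]
  intro E hE
  by_cases hEj : E j = 0
  · set D : σ →₀ ℕ := E.update j (o - q) with hD
    have hDj : D j = o - q := by rw [hD, update_apply', if_pos rfl]
    have hDE : D.update j 0 = E := by
      ext k
      rw [update_apply', hD, update_apply']
      split_ifs with hk
      · rw [hk, hEj]
      · rfl
    have hdeg : D.degree = E.degree + (o - q) := by
      have := degree_update_add E j (o - q)
      rw [hEj] at this
      rw [hD]; omega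
    rw [← hDE, ← coeff_pointTransform_layer q j b hbj s hqo hDj]
    refine coeff_pointTransform_eq_zero_of_lt hq j b s hequi ho' ho'2 ?_ (by omega) ?_
    · intro h0
      have := hDj
      rw [h0, Finsupp.zero_apply] at this
      omega
    · intro i hi
      have := hDj
      rw [hi, Finsupp.single_apply] at this
      split_ifs at this <;> omega
  · exact coeff_translate_initLayer_eq_zero j b hbj s.F o hEj

omit [DecidableEq K] [Fintype σ] in
/-- **FACTORISATION (PROVED)**: the initial layer is the boundary monomial (away from `u_j`) times the residual layer,
`L = u^{r[j↦0]} · M`, when `u^r` divides `F`. [folklore] -/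
theorem initLayer_eq_mul (j : σ) (s : State σ K) (hr : ∀ d ∈ s.F.support, s.r ≤ d) (o : ℕ) :
    initLayer j s.F o = monomial (s.r.update j 0) 1 * resLayer j s o := by
  classical
  unfold initLayer resLayer
  rw [Finset.mul_sum]
  refine Finset.sum_congr rfl fun d hd => ?_
  have hexp : s.r.update j 0 + (d - s.r).update j 0 = d.update j 0 := by
    ext k
    have hle : s.r k ≤ d k := Finsupp.le_def.mp (hr d (Finset.mem_filter.mp hd).1) k
    rw [Finsupp.add_apply, update_apply', update_apply', update_apply', Finsupp.tsub_apply]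
    split_ifs <;> omega
  rw [monomial_mul, one_mul, hexp]

/-- The boundary factor at the point `b`: its coefficient at the kept exponent is the unit `∏_{b_i ≠ 0} b_i^{r_i}`.
[folklore] -/
theorem coeff_translate_boundary (j : σ) (b : σ → K) (hbj : b j = 0) (r : σ →₀ ℕ) :
    coeff ((r.filter (fun i => b i = 0)).erase j) (translate b (monomial (r.update j 0) (1 : K))) =
      ∏ i, (if b i = 0 then (1 : K) else b i ^ r i) := by
  classical
  rw [coeff_translate_monomial, one_mul]
  refine Finset.prod_congr rfl fun i _ => ?_
  by_cases hij : i = j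
  · subst hij
    rw [Finsupp.erase_same, update_apply', if_pos rfl, if_pos hbj]
    simp
  · rw [Finsupp.erase_ne hij, Finsupp.filter_apply, update_apply', if_neg hij]
    by_cases hbi : b i = 0
    · rw [if_pos hbi, if_pos hbi]; simp
    · rw [if_neg hbi, if_neg hbi]; simp

/-- … hence the boundary factor has order at most the kept mass. [folklore] -/
theorem ordZero_translate_boundary_le (j : σ) (b : σ → K) (hbj : b j = 0) (r : σ →₀ ℕ) :
    ordZero (translate b (monomial (r.update j 0) (1 : K))) ≤ (((r.filter (fun i => b i = 0)).erase j).degree : ℕ∞) := by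
  classical
  refine ordZero_le_of_coeff_ne_zero _ _ ?_
  rw [coeff_translate_boundary j b hbj r]
  refine Finset.prod_ne_zero_iff.mpr fun i _ => ?_
  split_ifs with h
  · exact one_ne_zero
  · exact pow_ne_zero _ h

omit [DecidableEq K] in
/-- Exponents of the residual layer have degree `≤ o − |r|`. [folklore] -/
theorem degree_le_of_coeff_resLayer_ne_zero (j : σ) (s : State σ K) (hr : ∀ d ∈ s.F.support, s.r ≤ d) (o : ℕ)
    {E : σ →₀ ℕ} (hE : coeff E (resLayer j s o) ≠ 0) : E.degree ≤ o - s.r.degree := by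
  classical
  unfold resLayer at hE
  rw [coeff_sum] at hE
  obtain ⟨d, hd, hne⟩ := Finset.exists_ne_zero_of_sum_ne_zero hE
  rw [coeff_monomial] at hne
  split_ifs at hne with heq
  · obtain ⟨hdF, hdo⟩ := Finset.mem_filter.mp hd
    have hrd : s.r ≤ d := hr d hdF
    have h1 : (d - s.r).degree + s.r.degree = d.degree := by
      rw [← map_add, tsub_add_cancel_of_le hrd]
    have h2 := degree_update_add (d - s.r) j 0
    rw [heq] at h2
    omega
  · exact absurd rfl hne

omit [DecidableEq K] in
/-- … and so do those of its translate. [folklore] -/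
theorem degree_le_of_coeff_translate_resLayer_ne_zero (j : σ) (b : σ → K) (s : State σ K)
    (hr : ∀ d ∈ s.F.support, s.r ≤ d) (o : ℕ) {E : σ →₀ ℕ} (hE : coeff E (translate b (resLayer j s o)) ≠ 0) :
    E.degree ≤ o - s.r.degree := by
  classical
  have hsum : translate b (resLayer j s o) =
      ∑ d ∈ s.F.support with d.degree = o, translate b (monomial ((d - s.r).update j 0) (coeff d s.F)) := by
    unfold resLayer; rw [translate_finset_sum]
  rw [hsum, coeff_sum] at hE
  obtain ⟨d, hd, hne⟩ := Finset.exists_ne_zero_of_sum_ne_zero hE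
  have hle := degree_le_degree_of_le (le_of_coeff_translate_monomial_ne_zero b hne)
  have hc : coeff ((d - s.r).update j 0) (resLayer j s o) ≠ 0 := by
    unfold resLayer
    rw [coeff_sum, Finset.sum_eq_single d]
    · rw [coeff_monomial, if_pos rfl]
      exact MvPolynomial.mem_support_iff.mp (Finset.mem_filter.mp hd).1
    · intro d' hd' hne'
      rw [coeff_monomial, if_neg]
      intro heq
      apply hne'
      obtain ⟨hd'F, hd'o⟩ := Finset.mem_filter.mp hd'
      obtain ⟨hdF, hdo⟩ := Finset.mem_filter.mp hd
      have h1 : ∀ k, k ≠ j → d' k = d k := by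
        intro k hk
        have := DFunLike.congr_fun heq k
        rw [update_apply', update_apply', if_neg hk, if_neg hk, Finsupp.tsub_apply, Finsupp.tsub_apply] at this
        have h3 := Finsupp.le_def.mp (hr d hdF) k
        have h4 := Finsupp.le_def.mp (hr d' hd'F) k
        omega
      ext k
      by_cases hk : k = j
      · subst hk
        have e1 := degree_eq_add_sum_erase k d
        have e2 := degree_eq_add_sum_erase k d'
        have e3 : ∑ i ∈ univ.erase k, d' i = ∑ i ∈ univ.erase k, d i :=
          Finset.sum_congr rfl fun i hi => h1 i (Finset.ne_of_mem_erase hi)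
        omega
      · exact h1 k hk
    · intro h; exact absurd hd h
  exact hle.trans (degree_le_of_coeff_resLayer_ne_zero j s hr o hc)

omit [DecidableEq K] in
/-- The residual layer of a state of order `o` is non-zero. [folklore] -/
theorem resLayer_ne_zero (j : σ) (s : State σ K) (hr : ∀ d ∈ s.F.support, s.r ≤ d) {o : ℕ} (ho : ordZero s.F = o) :
    resLayer j s o ≠ 0 := by
  classical
  obtain ⟨⟨d, hd, hdo⟩, -⟩ := (ordZero_eq_nat_iff _ _).mp ho
  have hdF : d ∈ s.F.support := MvPolynomial.mem_support_iff.mpr hd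
  intro h0
  have hc : coeff ((d - s.r).update j 0) (resLayer j s o) = coeff d s.F := by
    unfold resLayer
    rw [coeff_sum, Finset.sum_eq_single d]
    · rw [coeff_monomial, if_pos rfl]
    · intro d' hd' hne'
      rw [coeff_monomial, if_neg]
      intro heq
      apply hne'
      obtain ⟨hd'F, hd'o⟩ := Finset.mem_filter.mp hd'
      have h1 : ∀ k, k ≠ j → d' k = d k := by
        intro k hk
        have := DFunLike.congr_fun heq k
        rw [update_apply', update_apply', if_neg hk, if_neg hk, Finsupp.tsub_apply, Finsupp.tsub_apply] at this
        have h3 := Finsupp.le_def.mp (hr d hdF) k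
        have h4 := Finsupp.le_def.mp (hr d' hd'F) k
        omega
      ext k
      by_cases hk : k = j
      · subst hk
        have e1 := degree_eq_add_sum_erase k d
        have e2 := degree_eq_add_sum_erase k d'
        have e3 : ∑ i ∈ univ.erase k, d' i = ∑ i ∈ univ.erase k, d i :=
          Finset.sum_congr rfl fun i hi => h1 i (Finset.ne_of_mem_erase hi)
        omega
      · exact h1 k hk
    · intro h
      exact absurd (Finset.mem_filter.mpr ⟨hdF, hdo⟩) h
  rw [h0, coeff_zero] at hc
  exact hd hc.symm

end StateLevel

end Summit.ResolutionOfSingularities.ResolutionOfSingularities.Theorems.ConeCut
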